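import Literature.NumberTheory.LFunctions.XiTiltedPotentialTails
import Literature.NumberTheory.LFunctions.XiMomentConcentration

/-!
# Route `JensenPolynomials`, FAR crux `XiCumulantSkew98Far` — part 1: the Stein identity for the tilted laws
`ν_s ∝ u^sΦ(u)du` and the a-priori even moments about the mode (RH-FREE; cell rh-jensen, HUMAN RULING D-0040)

For `s ≥ 1` natural, `Φ = deBruijnPhi`, the potential `W_s = −s log u − log Φ` (`xiPotential`, `W_s′ = xiPotentialDeriv s`,
`e^{−W_s} = u^sΦ`) and any centre `a : ℝ`, integration by parts on `(0, ∞)` (`integral_Ioi_mul_deriv_eq_deriv_mul`;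
boundary terms vanish because `u^s` kills `u = 0` and the product has an integrable derivative) gives the STEIN IDENTITY

  `j · ∫₀^∞ Φu^s (u − a)^{j−1} du = ∫₀^∞ Φu^s (u − a)^j W_s′(u) du`   (`stein`; `j = 0`: `∫ Φu^s W_s′ = 0`).

With `a = a_s = xiMode s` (the zero of `W_s′`) the integrand on the right of `stein (2n−1)` is `≥ (s/a²)(u−a)^{2n}Φu^s`
(`sub_mul_xiPotentialDeriv_ge`: `W_s″ ≥ s/u² ≥ s/a²` left of the mode, `W_s″ ≥ 16πe^{4a} ≥ s/a²` right of it), whence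
the a-priori Gaussian-order bound on the even moments about the mode, by induction,

  `∫₀^∞ Φu^s (u − a_s)^{2n} ≤ (2n−1)‼ · (a_s²/s)^n · M_s`   (`evenMoment_le`, `M_s = xiMoment s`).

These are the two inputs of the «Stein-moment» proof of the far skewness cap `q(M) ≤ 81/2` (M ≥ 2·10¹⁸) for the Taylor data
of `ξ` (route item `XiCumulantSkew98Far`; parts 2–4 in the sibling files). WHAT THIS IS NOT: statements about the Pólya–de
Bruijn kernel on `(0, ∞)`; nothing here bears on the zeros of `ζ`. References: Stein's identity / integration by parts for
log-concave Gibbs laws (folklore); Coffey–Csordas 2013 Thm 2.4 [CoffeyCsordas2013]; GORZ 2019 Thm 7 [GORZPNAS2019].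
-/

noncomputable section
-- D-0017: `Summit.RiemannHypothesis.RiemannHypothesis.…` duplicates the namespace BY DESIGN (single-problem summit).
set_option linter.dupNamespace false

namespace Summit.RiemannHypothesis.RiemannHypothesis.Theorems.JensenPolynomials.SkewFar

open Literature.NumberTheory.LFunctions Literature.Probability.Distributions MeasureTheory Set Filter Real
open scoped Topology Nat

/-! ## 1. Integrability against `Φ′` -/

/-- `|Φ′(u)| ≤ 4πe^{4u}·Φ(u)` for `u ≥ 0` (`Φ′ ≤ 0` and the upper envelope `−Φ′ ≤ (4πe^{4u} − 9)Φ`). -/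
theorem abs_deBruijnPhiDeriv_le {u : ℝ} (hu : 0 ≤ u) :
    |deBruijnPhiDeriv u| ≤ 4 * π * exp (4 * u) * deBruijnPhi u := by
  have h1 := neg_deBruijnPhiDeriv_le hu
  have h2 := deBruijnPhiDeriv_nonpos hu
  have hΦ := deBruijnPhi_pos_holds u
  rw [abs_of_nonpos h2]
  nlinarith

/-- `u^n · e^{Yu} · Φ(u)` is integrable on `(0, ∞)` (`u^n ≤ n!·e^u` and the tree's `integrableOn_deBruijnHBound`). -/
theorem integrableOn_pow_mul_exp_mul_deBruijnPhi (n : ℕ) (Y : ℝ) :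
    IntegrableOn (fun u : ℝ => u ^ n * exp (Y * u) * deBruijnPhi u) (Ioi 0) := by
  have h := (integrableOn_deBruijnHBound 0 (Y + 1)).const_mul (n ! : ℝ)
  refine h.mono' ?_ (ae_restrict_of_forall_mem measurableSet_Ioi fun u hu => ?_)
  · exact ((by fun_prop : Continuous fun u : ℝ => u ^ n * exp (Y * u)).mul
      continuous_deBruijnPhi).aestronglyMeasurable.restrict
  · have hu' : 0 ≤ u := le_of_lt hu
    have hΦ := deBruijnPhi_pos_holds u
    rw [Real.norm_eq_abs, abs_of_nonneg (by positivity), deBruijnHBound, zero_mul, Real.exp_zero, one_mul,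
      abs_of_pos hΦ]
    have hp := pow_le_factorial_mul_exp hu' n
    calc u ^ n * exp (Y * u) * deBruijnPhi u ≤ ((n ! : ℝ) * exp u) * exp (Y * u) * deBruijnPhi u := by gcongr
      _ = (n ! : ℝ) * (deBruijnPhi u * exp ((Y + 1) * u)) := by
          rw [add_mul, one_mul, Real.exp_add]; ring

/-- `(u − a)^j · u^s · Φ′(u)` is integrable on `(0, ∞)`. -/
theorem integrableOn_subPow_mul_pow_mul_deBruijnPhiDeriv (s j : ℕ) (a : ℝ) :
    IntegrableOn (fun u : ℝ => (u - a) ^ j * u ^ s * deBruijnPhiDeriv u) (Ioi 0) := by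
  have h := ((integrableOn_pow_mul_exp_mul_deBruijnPhi (j + s) 4).add
    ((integrableOn_pow_mul_exp_mul_deBruijnPhi s 4).const_mul (|a| ^ j))).const_mul (4 * π * 2 ^ j)
  refine h.mono' ?_ (ae_restrict_of_forall_mem measurableSet_Ioi fun u hu => ?_)
  · exact ((by fun_prop : Continuous fun u : ℝ => (u - a) ^ j * u ^ s).mul
      continuous_deBruijnPhiDeriv).aestronglyMeasurable.restrict
  · have hu' : 0 ≤ u := le_of_lt hu
    have hΦ := deBruijnPhi_pos_holds u
    rw [Real.norm_eq_abs, abs_mul, abs_mul, abs_of_nonneg (pow_nonneg hu' s), abs_pow]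
    have hD := abs_deBruijnPhiDeriv_le hu'
    have hsub : |u - a| ^ j ≤ 2 ^ j * (u ^ j + |a| ^ j) := by
      calc |u - a| ^ j ≤ (u + |a|) ^ j := by
            apply pow_le_pow_left₀ (abs_nonneg _)
            calc |u - a| ≤ |u| + |a| := abs_sub u a
              _ = u + |a| := by rw [abs_of_nonneg hu']
        _ ≤ 2 ^ j * (u ^ j + |a| ^ j) := add_pow_le_two_pow hu' (abs_nonneg a) j
    calc |u - a| ^ j * u ^ s * |deBruijnPhiDeriv u|
        ≤ (2 ^ j * (u ^ j + |a| ^ j)) * u ^ s * (4 * π * exp (4 * u) * deBruijnPhi u) := by gcongr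
      _ = (4 * π * 2 ^ j) * (u ^ (j + s) * exp (4 * u) * deBruijnPhi u +
            |a| ^ j * (u ^ s * exp (4 * u) * deBruijnPhi u)) := by ring

/-! ## 2. Integration by parts and the Stein identity -/

/-- **Integration by parts against `Φ` on `(0, ∞)`**: for `s ≥ 1` and the polynomial `P(u) = (u − a)^j u^s`,
`∫₀^∞ P′Φ = −∫₀^∞ PΦ′` (the boundary terms vanish: `P(0) = 0`, and `PΦ → 0` at `∞` because `PΦ` and `(PΦ)′` are
integrable). -/
theorem stein_ibp (s j : ℕ) (hs : 1 ≤ s) (a : ℝ) :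
    ∫ u in Ioi 0, ((j : ℝ) * (u - a) ^ (j - 1) * u ^ s + (s : ℝ) * (u - a) ^ j * u ^ (s - 1)) * deBruijnPhi u
      = -∫ u in Ioi 0, (u - a) ^ j * u ^ s * deBruijnPhiDeriv u := by
  set P : ℝ → ℝ := fun u => (u - a) ^ j * u ^ s with hPdef
  set P' : ℝ → ℝ := fun u => (j : ℝ) * (u - a) ^ (j - 1) * u ^ s + (s : ℝ) * (u - a) ^ j * u ^ (s - 1)
    with hP'def
  have hP : ∀ x, HasDerivAt P (P' x) x := by
    intro x
    have h1 : HasDerivAt (fun u : ℝ => (u - a) ^ j) ((j : ℝ) * (x - a) ^ (j - 1) * 1) x :=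
      ((hasDerivAt_id x).sub_const a).pow j
    have h2 : HasDerivAt (fun u : ℝ => u ^ s) ((s : ℝ) * x ^ (s - 1)) x := hasDerivAt_pow s x
    have h := h1.mul h2
    refine h.congr_deriv ?_
    simp only [hP'def]
    ring
  -- integrability of `P′Φ`, `PΦ′`, `PΦ`
  have hI1 : IntegrableOn (fun u => P' u * deBruijnPhi u) (Ioi 0) := by
    have h := ((integrableOn_deBruijnPhi_mul_pow_mul_sub_pow s (j - 1) a).const_mul (j : ℝ)).add
      ((integrableOn_deBruijnPhi_mul_pow_mul_sub_pow (s - 1) j a).const_mul (s : ℝ))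
    refine IntegrableOn.congr_fun h (fun u _ => ?_) measurableSet_Ioi
    simp only [hP'def, Pi.add_apply]
    ring
  have hI2 : IntegrableOn (fun u => P u * deBruijnPhiDeriv u) (Ioi 0) :=
    integrableOn_subPow_mul_pow_mul_deBruijnPhiDeriv s j a
  have hI3 : IntegrableOn (fun u => P u * deBruijnPhi u) (Ioi 0) := by
    refine IntegrableOn.congr_fun (integrableOn_deBruijnPhi_mul_pow_mul_sub_pow s j a) (fun u _ => ?_)
      measurableSet_Ioi
    simp only [hPdef]
    ring
  -- boundary behaviour
  have hcont : Continuous fun u => P u * deBruijnPhi u :=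
    (by fun_prop : Continuous fun u : ℝ => (u - a) ^ j * u ^ s).mul continuous_deBruijnPhi
  have hs0 : s ≠ 0 := by omega
  have hzero : Tendsto (P * deBruijnPhi) (𝓝[>] (0 : ℝ)) (𝓝 0) := by
    have h := hcont.tendsto 0
    have e : P 0 * deBruijnPhi 0 = 0 := by simp [hPdef, zero_pow hs0]
    rw [e] at h
    exact h.mono_left nhdsWithin_le_nhds
  have hderiv : ∀ x ∈ Ioi (0 : ℝ), HasDerivAt (P * deBruijnPhi) (P' x * deBruijnPhi x + P x * deBruijnPhiDeriv x) x :=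
    fun x _ => (hP x).mul (hasDerivAt_deBruijnPhi x)
  have hinfty : Tendsto (P * deBruijnPhi) atTop (𝓝 0) :=
    tendsto_zero_of_hasDerivAt_of_integrableOn_Ioi (a := 0) hderiv (hI1.add hI2) hI3
  have key := integral_Ioi_mul_deriv_eq_deriv_mul (a := 0) (u := P) (v := deBruijnPhi) (u' := P')
    (v' := deBruijnPhiDeriv) (a' := 0) (b' := 0) (fun x _ => hP x) (fun x _ => hasDerivAt_deBruijnPhi x)
    hI2 hI1 hzero hinfty
  -- `key : ∫ PΦ′ = 0 − 0 − ∫ P′Φ`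
  have e : ∫ u in Ioi 0, P' u * deBruijnPhi u = -∫ u in Ioi 0, P u * deBruijnPhiDeriv u := by
    rw [key]; ring
  simpa only [hPdef, hP'def] using e

/-- Pointwise form of the Stein integrand: for `u > 0` and `s ≥ 1`,
`Φu^s · (u−a)^j W_s′(u) = (u−a)^j u^s (−Φ′(u)) − s (u−a)^j u^{s−1} Φ(u)`. -/
theorem stein_integrand_eq (s j : ℕ) (hs : 1 ≤ s) (a : ℝ) {u : ℝ} (hu : 0 < u) :
    deBruijnPhi u * u ^ s * ((u - a) ^ j * xiPotentialDeriv s u) =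
      -((u - a) ^ j * u ^ s * deBruijnPhiDeriv u) - (s : ℝ) * (u - a) ^ j * u ^ (s - 1) * deBruijnPhi u := by
  have hΦ := (deBruijnPhi_pos_holds u).ne'
  obtain ⟨r, rfl⟩ : ∃ r, s = r + 1 := ⟨s - 1, by omega⟩
  rw [xiPotentialDeriv, phiNegLogDeriv, show r + 1 - 1 = r from rfl, pow_succ]
  push_cast
  field_simp
  ring

/-- **Stein identity for `ν_s`**: for `s ≥ 1`, `j : ℕ` and any `a : ℝ`,
`j · ∫₀^∞ Φu^s (u−a)^{j−1} = ∫₀^∞ Φu^s (u−a)^j W_s′(u)`  (`E[g′] = E[g·W′]` for `g = (u−a)^j`; for `j = 0` it says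
`∫ Φu^s W_s′ = 0`). -/
theorem stein (s j : ℕ) (hs : 1 ≤ s) (a : ℝ) :
    (j : ℝ) * ∫ u in Ioi 0, deBruijnPhi u * u ^ s * (u - a) ^ (j - 1) =
      ∫ u in Ioi 0, deBruijnPhi u * u ^ s * ((u - a) ^ j * xiPotentialDeriv s u) := by
  have hibp := stein_ibp s j hs a
  have hA : IntegrableOn (fun u : ℝ => (u - a) ^ j * u ^ s * deBruijnPhiDeriv u) (Ioi 0) :=
    integrableOn_subPow_mul_pow_mul_deBruijnPhiDeriv s j a
  have hB : IntegrableOn (fun u : ℝ => (s : ℝ) * (u - a) ^ j * u ^ (s - 1) * deBruijnPhi u) (Ioi 0) := by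
    refine IntegrableOn.congr_fun ((integrableOn_deBruijnPhi_mul_pow_mul_sub_pow (s - 1) j a).const_mul (s : ℝ))
      (fun u _ => ?_) measurableSet_Ioi
    ring
  have hC : IntegrableOn (fun u : ℝ => (j : ℝ) * (u - a) ^ (j - 1) * u ^ s * deBruijnPhi u) (Ioi 0) := by
    refine IntegrableOn.congr_fun ((integrableOn_deBruijnPhi_mul_pow_mul_sub_pow s (j - 1) a).const_mul (j : ℝ))
      (fun u _ => ?_) measurableSet_Ioi
    ring
  have hA' : IntegrableOn (fun u : ℝ => -((u - a) ^ j * u ^ s * deBruijnPhiDeriv u)) (Ioi 0) := hA.neg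
  -- rewrite the right-hand side pointwise and split
  have e1 : ∫ u in Ioi 0, deBruijnPhi u * u ^ s * ((u - a) ^ j * xiPotentialDeriv s u) =
      ∫ u in Ioi 0, (-((u - a) ^ j * u ^ s * deBruijnPhiDeriv u) -
        (s : ℝ) * (u - a) ^ j * u ^ (s - 1) * deBruijnPhi u) :=
    setIntegral_congr_fun measurableSet_Ioi fun u hu => stein_integrand_eq s j hs a hu
  rw [e1, integral_sub hA' hB, integral_neg]
  -- the left-hand side of `stein_ibp`, split
  have e2 : ∫ u in Ioi 0, ((j : ℝ) * (u - a) ^ (j - 1) * u ^ s + (s : ℝ) * (u - a) ^ j * u ^ (s - 1)) * deBruijnPhi u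
      = (∫ u in Ioi 0, (j : ℝ) * (u - a) ^ (j - 1) * u ^ s * deBruijnPhi u) +
        ∫ u in Ioi 0, (s : ℝ) * (u - a) ^ j * u ^ (s - 1) * deBruijnPhi u := by
    rw [← integral_add hC hB]
    refine setIntegral_congr_fun measurableSet_Ioi fun u _ => ?_
    ring
  have e3 : ∫ u in Ioi 0, (j : ℝ) * (u - a) ^ (j - 1) * u ^ s * deBruijnPhi u =
      (j : ℝ) * ∫ u in Ioi 0, deBruijnPhi u * u ^ s * (u - a) ^ (j - 1) := by
    rw [← integral_const_mul]
    refine setIntegral_congr_fun measurableSet_Ioi fun u _ => ?_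
    ring
  rw [e2, e3] at hibp
  linarith

/-! ## 3. Positivity of `(u − a_s)·W_s′(u)` and the a-priori even moments -/

/-- At the mode `a = a_s` (`s ≥ 1`) one has `a ≥ 1/4 ⇒ s/a² ≤ 16πe^{4a}` — because `s/a = L(a) ≤ 4πe^{4a} − 9`. -/
theorem div_sq_le_curv_right (s : ℕ) (hs : 1 ≤ s) (ha : 1 / 4 ≤ xiMode s) :
    (s : ℝ) / xiMode s ^ 2 ≤ 16 * π * exp (4 * xiMode s) := by
  have hs' : (0 : ℝ) < s := by exact_mod_cast hs
  have ha0 := xiMode_pos hs'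
  have hmode := xiMode_mul_phiNegLogDeriv hs'
  have henv := neg_deBruijnPhiDeriv_div_le ha0.le
  rw [show -deBruijnPhiDeriv (xiMode s) / deBruijnPhi (xiMode s) = phiNegLogDeriv (xiMode s) from rfl] at henv
  -- `s ≤ a·4πe^{4a}`
  have h1 : (s : ℝ) ≤ xiMode s * (4 * π * exp (4 * xiMode s)) := by
    have : phiNegLogDeriv (xiMode s) ≤ 4 * π * exp (4 * xiMode s) := by linarith
    calc (s : ℝ) = xiMode s * phiNegLogDeriv (xiMode s) := hmode.symm
      _ ≤ xiMode s * (4 * π * exp (4 * xiMode s)) := mul_le_mul_of_nonneg_left this ha0.le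
  rw [div_le_iff₀ (pow_pos ha0 2)]
  have hE : 0 < exp (4 * xiMode s) := exp_pos _
  nlinarith [mul_pos Real.pi_pos hE]

/-- **Positivity**: with `a = a_s` the mode of `W_s` (`s ≥ 1`, `a ≥ 1/4`), for every `u > 0`:
`(s/a²)·(u − a)² ≤ (u − a)·W_s′(u)` (curvature floor `s/a²` on both sides of the mode). -/
theorem sub_mul_xiPotentialDeriv_ge (s : ℕ) (hs : 1 ≤ s) (ha : 1 / 4 ≤ xiMode s) {u : ℝ} (hu : 0 < u) :
    (s : ℝ) / xiMode s ^ 2 * (u - xiMode s) ^ 2 ≤ (u - xiMode s) * xiPotentialDeriv s u := by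
  have hs' : (0 : ℝ) < s := by exact_mod_cast hs
  set a := xiMode s with ha_def
  have ha0 : 0 < a := xiMode_pos hs'
  have hcrit : xiPotentialDeriv s a = 0 := xiPotentialDeriv_xiMode hs'
  rcases le_total u a with hua | hau
  · -- left of the mode: floor `s/u'² ≥ s/a²` on `[u, a]`
    have hg₁ : ∀ x ∈ Icc u a, HasDerivAt (xiPotentialDeriv s) (xiPotentialDeriv₂ s x) x :=
      fun x hx => hasDerivAt_xiPotentialDeriv s (ne_of_gt (lt_of_lt_of_le hu hx.1))
    have hρ : ∀ x ∈ Icc u a, (s : ℝ) / a ^ 2 ≤ xiPotentialDeriv₂ s x := by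
      intro x hx
      have hx0 : 0 < x := lt_of_lt_of_le hu hx.1
      have h := xiPotentialDeriv₂_gt_of_pos (s : ℝ) hx0
      have h1 : (s : ℝ) / a ^ 2 ≤ s / x ^ 2 :=
        div_le_div_of_nonneg_left hs'.le (pow_pos hx0 2) (pow_le_pow_left₀ hx0.le hx.2 2)
      have h2 : 0 < 16 * π * exp (4 * x) := by positivity
      linarith
    have h := mul_sub_le_neg_deriv_of_le_deriv2 hua hg₁ hρ hcrit
    -- `ρ(a − u) ≤ −W′(u)` ⇒ multiply by `a − u ≥ 0`
    have hau' : 0 ≤ a - u := sub_nonneg.2 hua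
    nlinarith [mul_le_mul_of_nonneg_left h hau']
  · -- right of the mode: floor `16πe^{4x} ≥ 16πe^{4a} ≥ s/a²` on `[a, u]`
    have hg₁ : ∀ x ∈ Icc a u, HasDerivAt (xiPotentialDeriv s) (xiPotentialDeriv₂ s x) x :=
      fun x hx => hasDerivAt_xiPotentialDeriv s (ne_of_gt (lt_of_lt_of_le ha0 hx.1))
    have hfloor := div_sq_le_curv_right s hs ha
    have hρ : ∀ x ∈ Icc a u, (s : ℝ) / a ^ 2 ≤ xiPotentialDeriv₂ s x := by
      intro x hx
      have hx0 : 0 < x := lt_of_lt_of_le ha0 hx.1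
      have h := xiPotentialDeriv₂_gt_of_pos (s : ℝ) hx0
      have h1 : exp (4 * a) ≤ exp (4 * x) := exp_le_exp.2 (by linarith [hx.1])
      have h2 : 0 ≤ (s : ℝ) / x ^ 2 := by positivity
      nlinarith [Real.pi_pos]
    have h := mul_sub_le_deriv_of_le_deriv2 hau hg₁ hρ hcrit
    have hua' : 0 ≤ u - a := sub_nonneg.2 hau
    nlinarith [mul_le_mul_of_nonneg_left h hua']

/-- **One step of the moment recursion**: `(s/a²)·∫ Φu^s(u−a)^{2n+2} ≤ (2n+1)·∫ Φu^s (u−a)^{2n}` at `a = a_s`. -/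
theorem evenMoment_step (s : ℕ) (hs : 1 ≤ s) (ha : 1 / 4 ≤ xiMode s) (n : ℕ) :
    (s : ℝ) / xiMode s ^ 2 * ∫ u in Ioi 0, deBruijnPhi u * u ^ s * (u - xiMode s) ^ (2 * n + 2) ≤
      (2 * n + 1 : ℝ) * ∫ u in Ioi 0, deBruijnPhi u * u ^ s * (u - xiMode s) ^ (2 * n) := by
  set a := xiMode s with ha_def
  have hst := stein s (2 * n + 1) hs a
  have e : ((2 * n + 1 : ℕ) : ℝ) = 2 * n + 1 := by push_cast; ring
  rw [e, show 2 * n + 1 - 1 = 2 * n from rfl] at hst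
  rw [hst, ← integral_const_mul]
  have hI1 : IntegrableOn (fun u => (s : ℝ) / a ^ 2 * (deBruijnPhi u * u ^ s * (u - a) ^ (2 * n + 2))) (Ioi 0) :=
    (integrableOn_deBruijnPhi_mul_pow_mul_sub_pow s (2 * n + 2) a).const_mul _
  have hI2 : IntegrableOn (fun u => deBruijnPhi u * u ^ s * ((u - a) ^ (2 * n + 1) * xiPotentialDeriv s u)) (Ioi 0) := by
    have hA := (integrableOn_subPow_mul_pow_mul_deBruijnPhiDeriv s (2 * n + 1) a).neg
    have hB := (integrableOn_deBruijnPhi_mul_pow_mul_sub_pow (s - 1) (2 * n + 1) a).const_mul (s : ℝ)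
    refine IntegrableOn.congr_fun (hA.sub hB) (fun u hu => ?_) measurableSet_Ioi
    rw [stein_integrand_eq s (2 * n + 1) hs a hu]
    simp only [Pi.neg_apply, Pi.sub_apply]
    ring
  refine setIntegral_mono_on hI1 hI2 measurableSet_Ioi fun u hu => ?_
  have hpos := sub_mul_xiPotentialDeriv_ge s hs ha hu
  have hw : 0 ≤ deBruijnPhi u * u ^ s * (u - a) ^ (2 * n) :=
    mul_nonneg (mul_pos (deBruijnPhi_pos_holds u) (pow_pos hu s)).le (Even.pow_nonneg (even_two_mul n) _)
  calc (s : ℝ) / a ^ 2 * (deBruijnPhi u * u ^ s * (u - a) ^ (2 * n + 2))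
      = (deBruijnPhi u * u ^ s * (u - a) ^ (2 * n)) * ((s : ℝ) / a ^ 2 * (u - a) ^ 2) := by ring
    _ ≤ (deBruijnPhi u * u ^ s * (u - a) ^ (2 * n)) * ((u - a) * xiPotentialDeriv s u) :=
        mul_le_mul_of_nonneg_left hpos hw
    _ = deBruijnPhi u * u ^ s * ((u - a) ^ (2 * n + 1) * xiPotentialDeriv s u) := by ring

/-- **A-priori even moments about the mode**: `∫₀^∞ Φu^s(u − a_s)^{2n} ≤ (2n−1)‼·(a_s²/s)^n·M_s` for every `n`
(`s ≥ 1`, `a_s ≥ 1/4`). -/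
theorem evenMoment_le (s : ℕ) (hs : 1 ≤ s) (ha : 1 / 4 ≤ xiMode s) (n : ℕ) :
    ∫ u in Ioi 0, deBruijnPhi u * u ^ s * (u - xiMode s) ^ (2 * n) ≤
      ((2 * n - 1)‼ : ℝ) * (xiMode s ^ 2 / s) ^ n * xiMoment s := by
  have hs' : (0 : ℝ) < s := by exact_mod_cast hs
  set a := xiMode s with ha_def
  have ha0 : 0 < a := xiMode_pos hs'
  induction n with
  | zero =>
    simp only [mul_zero, pow_zero, mul_one, Nat.zero_sub, Nat.doubleFactorial, Nat.cast_one, one_mul, xiMoment,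
      le_refl]
  | succ n ih =>
    have hstep := evenMoment_step s hs ha n
    rw [← ha_def] at hstep
    have hρ : 0 < (s : ℝ) / a ^ 2 := by positivity
    rw [show 2 * (n + 1) = 2 * n + 2 by ring]
    -- `∫ t^{2n+2} ≤ (a²/s)(2n+1) ∫ t^{2n} ≤ (a²/s)(2n+1)(2n−1)‼ (a²/s)^n M_s`
    have h1 : ∫ u in Ioi 0, deBruijnPhi u * u ^ s * (u - a) ^ (2 * n + 2) ≤
        (a ^ 2 / s) * ((2 * n + 1 : ℝ) * ∫ u in Ioi 0, deBruijnPhi u * u ^ s * (u - a) ^ (2 * n)) := by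
      have hstep' := (le_div_iff₀' hρ).2 hstep
      calc ∫ u in Ioi 0, deBruijnPhi u * u ^ s * (u - a) ^ (2 * n + 2)
          ≤ ((2 * n + 1 : ℝ) * ∫ u in Ioi 0, deBruijnPhi u * u ^ s * (u - a) ^ (2 * n)) / ((s : ℝ) / a ^ 2) := hstep'
        _ = (a ^ 2 / s) * ((2 * n + 1 : ℝ) * ∫ u in Ioi 0, deBruijnPhi u * u ^ s * (u - a) ^ (2 * n)) := by
            field_simp
    have hdf : (((2 * (n + 1) - 1)‼ : ℕ) : ℝ) = (2 * n + 1 : ℝ) * (((2 * n - 1)‼ : ℕ) : ℝ) := by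
      rw [show 2 * (n + 1) - 1 = 2 * n + 1 by omega, Nat.doubleFactorial_add_one]
      push_cast
      ring
    calc ∫ u in Ioi 0, deBruijnPhi u * u ^ s * (u - a) ^ (2 * n + 2)
        ≤ (a ^ 2 / s) * ((2 * n + 1 : ℝ) * ∫ u in Ioi 0, deBruijnPhi u * u ^ s * (u - a) ^ (2 * n)) := h1
      _ ≤ (a ^ 2 / s) * ((2 * n + 1 : ℝ) * (((2 * n - 1)‼ : ℝ) * (a ^ 2 / s) ^ n * xiMoment s)) := by
          gcongr
      _ = ((2 * (n + 1) - 1)‼ : ℝ) * (a ^ 2 / s) ^ (n + 1) * xiMoment s := by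
          rw [hdf]; ring

end Summit.RiemannHypothesis.RiemannHypothesis.Theorems.JensenPolynomials.SkewFar

end
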